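import Summits.ABC.IUTFork.Cor312LicenceOfMultiReach
import Summits.ABC.IUTFork.Cor312LicenceShallowRealLevels
import Summits.ABC.IUTFork.Repair.RHPlaceCutGlue
import Summits.ABC.IUTFork.Repair.RHSlotReach
import HarnessLib

/-!
# R-H ROUND 1 row 15 `slotreach` — k2 (the MOVER LEMMA): `SlotReachWindow` ⟹ MULTI-REACH ⟹ S_H at `settingPrVolSharp`

PROOF-ONLY companion (0 definitions, 0 `Prop` facts) of `Repair/RHSlotReach.lean` (p457641; R-H round 1 row 15, RH-CANDIDATES v1.2,
author of H⋆ abc-iut-lens-wuc-1, typer abc-iut-rh-typ-12, k2 desk abc-iut-rp-d3). It discharges the ONE sorried lemma of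
abc-iut-lens-wuc-1's k2 sketch `HOME/staging/RH/lens-wuc-1/K2GLUE-slotreach.lean` (17:30Z) — `multiReach_of_slotReachWindow`:
H⋆ + its numeric dictionary ⟹ abc-iut-w5-d107's MULTI-REACH hypothesis at every packet of `𝔽_l^⋇` — and then carries the sketch's
three riders verbatim in the companion `Repair/RHSlotReachK2Hull.lean` (hull inclusion at every `(j, v_ℚ)` of `settingPrVolSharp`; branch C's
bundle `∃ ρ qK, QPinned ∧ PilotKummerCompatHull`; the constant-ρ `LatticeSituation.ofShells` clause = the shape of the binder `hSHw`).

THE MOVER (§6, one place, any residue characteristic, any ramification). For a NON-member `u ∉ log_p(𝒪_v^×)`, a member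
`z₀ ∈ log_p(𝒪_v^×)` and any scalar `c ∈ ℚ_p`, some `g` of Dupuy–Hilado's (Ind2) group `Real.ismDH logv v` has
`‖g(c·u)‖ ≥ ‖c‖·p·‖z₀‖`: write `u = d·x₀`, `z₀ = d'·z₁` with `x₀, z₁` PRIMITIVE in the lattice `log_p(𝒪_v^×)` (campaign-S
`PadicModule.exists_eq_smul_primitive`); `u ∉ Λ` forces `‖d‖ > 1`, i.e. `‖d‖ ≥ p` (norms on `ℚ_p` are powers of `p`), and `z₀ ∈ Λ` forces
`‖d'‖ ≤ 1`; Weil II §2 Th. 1 (`PadicModule.exists_latticeAut_map_eq`) gives a lattice automorphism `φ` with `φ x₀ = z₁`, realised in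
`Real.ismDH` by abc-iut-w5-d180's dictionary `exists_mem_ismDH_of_mem_latticeAut`; then `g(c·u) = c·d·z₁` has norm
`‖c‖·‖d‖·‖z₀‖/‖d'‖ ≥ ‖c‖·p·‖z₀‖`.
THE SLOTS (§7). Donor slot at `x`: `y := p^{1−C}·u_x`, `C = ⌈n₀(x)/e_x⌉`, is integral (`‖u_x‖ ≤ ‖ϖ_x‖^{n₀−1}`) and reaches
`p^{C + λ_x}` (`‖z_x‖ ≥ p^{λ_x}`). Active slot at a bad `w`: `y' := t_Θ⁻¹·p^{1−c}·u_w`, `c = ⌈(n₀(w) − mΘ)/e_w⌉`, is integral and `t_Θ·y'`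
reaches `p^{c + λ_w}`. The product of the reaches dominates `‖t_{q,w}‖ = ‖ϖ_w‖^{m_q}` iff the window inequality of `SlotReachWindow`
(§9 `multiReach_of_slotReachWindow`, §8 the bookkeeping); at a good `w` the identity movers do (both ideles are units there).

TAKES NO SIDE on [IUTchIII] Cor. 3.12 or on any author; `SlotReachWindow` stays a HYPOTHESIS (claim-tagged in the parent file), here only
an antecedent; nothing asserts abc proved or refuted; typed ≠ proved; instantiated ≠ endorsed. The riders (lens-wuc-1's)
are in `Repair/RHSlotReachK2Hull.lean`. [cite: WeilBNT1967, Ch. II §2, Th. 1] [cite: DupuyHilado2025, §3.9, §4.9]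
[cite: Mochizuki2012, IUTchIII Thm. 3.11 (i) (Ind2) p. 154; Cor. 3.12 Step (xi-f) p. 184] [claim: Mochizuki2012, status: disputed]
for every IUT locution. Axioms: standard.
-/

noncomputable section

open Set Function Metric NumberField IsDedekindDomain
open scoped Pointwise

/-! ## §6. One place: the (Ind2)-reach of `c • u` for a NON-member `u` of `log_p(𝒪_v^×)` -/

namespace Summit.ABC.IUTFork.Repair.RHSlotReach

open Thm311 Thm311.Real Cor312 Cor312.Setting Cor312Vol Literature.IUT.LogThetaLattice Literature.IUT.LogVolume
open Literature.NumberTheory.NumberFields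

section Local

variable {F : Type} [Field F] [NumberField F] {p : ℕ} [hp : Fact p.Prime]
  {logv : PadicLogs F} (hlog : LogvAnalyticAt p logv)
  (v : HeightOneSpectrum (𝓞 F)) (hv : ((p : ℕ) : 𝓞 F) ∈ v.asIdeal)

include hlog in
/-- **THE MOVER FROM A NON-MEMBER (one place, any `p`, any ramification).** If `u ∉ log_p(𝒪_v^×)` and `z₀ ∈ log_p(𝒪_v^×)`, then for
every scalar `c ∈ ℚ_p` some `g ∈ Real.ismDH logv v` has `‖c‖·p·‖z₀‖ ≤ ‖g(c·u)‖`: `u = d·x₀`, `z₀ = d'·z₁` with `x₀, z₁` primitive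
lattice vectors, `‖d‖ ≥ p` (as `u ∉ Λ`), `‖d'‖ ≤ 1` (as `z₀ ∈ Λ`); a lattice automorphism maps `x₀ ↦ z₁` (Weil II §2 Th. 1) and lies in
(Ind2) (abc-iut-w5-d180's dictionary). [cite: WeilBNT1967, Ch. II §2, Th. 1] [cite: DupuyHilado2025, §4.9] -/
theorem exists_mem_ismDH_norm_smul_ge_of_not_mem_logUnits {u z₀ : RescaledCompletion F p v hv}
    (hu : u ∉ logUnits (RescaledCompletion F p v hv)) (hz₀ : z₀ ∈ logUnits (RescaledCompletion F p v hv)) (c : ℚ_[p]) :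
    ∃ g ∈ ismDH logv (.inr v), ‖c‖ * p * ‖z₀‖ ≤ ‖toR p v hv (g (ofR p v hv (c • u)))‖ := by
  by_cases hz0 : z₀ = 0
  · refine ⟨LinearEquiv.refl ℚ _, refl_mem_ismDH logv _, ?_⟩
    rw [hz0, norm_zero, mul_zero]
    exact norm_nonneg _
  obtain ⟨n, hn, B, hΛ⟩ := exists_basis_coe_logUnits_eq (p := p) v hv
  rw [hΛ] at hu hz₀
  have hu0 : u ≠ 0 := by
    rintro rfl
    exact hu (zero_mem (PadicModule.basisLattice p B))
  -- `u = d • x₀`, `x₀` primitive, `‖d‖` = the content of `u`, which exceeds `1`, hence is `≥ p`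
  obtain ⟨d, x₀, i, hd0, hx₀, hi, hux, hud⟩ := PadicModule.exists_eq_smul_primitive p B hu0
  have hd : (p : ℝ) ≤ ‖d‖ := by
    have h1 : ¬ ∀ j, ‖B.repr u j‖ ≤ 1 := fun h => hu ((PadicModule.mem_basisLattice p B).2 h)
    push Not at h1
    obtain ⟨j, hj⟩ := h1
    have hdj : 1 < ‖d‖ := hj.trans_le (hud j)
    have key := Padic.norm_le_pow_iff_norm_lt_pow_add_one d 0
    rw [zpow_zero, zero_add, zpow_one] at key
    by_contra hlt
    exact absurd (key.2 (lt_of_not_ge hlt)) (not_le.2 hdj)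
  -- `z₀ = d' • z₁`, `z₁` primitive, `‖d'‖ ≤ 1`
  obtain ⟨d', z₁, i', hd'0, hz₁, hi', hzz, hzd⟩ := PadicModule.exists_eq_smul_primitive p B hz0
  have hd' : ‖d'‖ ≤ 1 := by
    have h := (PadicModule.mem_basisLattice p B).1 hz₀ i'
    rw [hzz, map_smul, Finsupp.smul_apply, smul_eq_mul, norm_mul, hi', mul_one] at h
    exact h
  -- a lattice automorphism with `φ x₀ = z₁`, realised in `Real.ismDH`
  obtain ⟨φ, hφ, hφx⟩ := PadicModule.exists_latticeAut_map_eq p B hx₀ hz₁ hi hi'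
  obtain ⟨g, hg, hgφ⟩ := exists_mem_ismDH_of_mem_latticeAut hlog B hΛ hφ
  refine ⟨g, hg, ?_⟩
  rw [hgφ, hux, smul_smul, map_smul, hφx, norm_smul, norm_mul]
  have hz₁n : ‖z₀‖ ≤ ‖z₁‖ := by
    rw [hzz, norm_smul]
    exact (mul_le_mul_of_nonneg_right hd' (norm_nonneg _)).trans_eq (one_mul _)
  have hc : 0 ≤ ‖c‖ := norm_nonneg _
  calc ‖c‖ * p * ‖z₀‖ ≤ ‖c‖ * ‖d‖ * ‖z₁‖ := by gcongr
    _ = ‖c‖ * ‖d‖ * ‖z₁‖ := rfl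

end Local

/-! ## §7. Fibre points of a pilot datum: the donor slot and the active slot -/

section Fibre

variable {F : Type} [Field F] [NumberField F] (X : PilotData F) {logv : PadicLogs F} (hlog : LogvAnalytic logv)

/-- §6 read at a fibre point `x ∣ p` of the index of a pilot datum, through the presentation `φ_x = id` of abc-iut-c312-5's
real signature (`presAt`). [cite: WeilBNT1967, Ch. II §2, Th. 1] [cite: DupuyHilado2025, §4.9] -/
theorem exists_mem_ismDH_norm_smul_ge_fibre (pp : Nat.Primes) (x : (thetaIndex X).Fibre (.inr pp)) :
    haveI : Fact (pp : ℕ).Prime := ⟨pp.2⟩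
    ∀ (c : ℚ_[pp]) (u z₀ : kOf X pp.1 x), u ∉ logUnits (kOf X pp.1 x) → z₀ ∈ logUnits (kOf X pp.1 x) →
      ∃ g ∈ ismDH logv x.1,
        ‖c‖ * pp * ‖z₀‖ ≤ ‖(presAt X hlog pp).φ x (g (((presAt X hlog pp).φ x).symm (c • u)))‖ := by
  haveI : Fact (pp : ℕ).Prime := ⟨pp.2⟩
  obtain ⟨x1, hx⟩ := x
  rcases x1 with w | v
  · exact absurd hx (by simp [thetaIndex])
  · intro c u z₀ hu hz₀
    obtain ⟨g, hg, hgn⟩ := exists_mem_ismDH_norm_smul_ge_of_not_mem_logUnits (hlog pp) v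
      (natCast_mem_placeOf X pp.1 ⟨.inr v, hx⟩) hu hz₀ c
    exact ⟨g, hg, hgn⟩


/-- **THE DONOR SLOT** at a place `x ∣ p` with dictionary `(e, n₀, λ, ϖ)` (`‖ϖ_x‖ = p^{−1/e}`, a non-member `u` of `log_p(𝒪_x^×)` with
`‖u‖ ≤ ‖ϖ_x‖^{n₀−1}`, a member `z` with `‖z‖ ≥ p^{λ}`): the integral slot value `y := p^{1−C}·u`, `C = ⌈n₀/e⌉`, is carried by some
`g ∈ Real.ismDH` to norm `≥ p^{λ + C}`. [cite: WeilBNT1967, Ch. II §2, Th. 1] [cite: DupuyHilado2025, §4.9] -/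
theorem exists_donor (pp : Nat.Primes) (x : (thetaIndex X).Fibre (.inr pp)) (e n₀ : ℕ) (lam : ℝ) (he : 1 ≤ e) :
    haveI : Fact (pp : ℕ).Prime := ⟨pp.2⟩
    ∀ ϖ : kOf X pp.1 x, ‖ϖ‖ = (pp : ℝ) ^ (-(1 : ℝ) / (e : ℝ)) →
      (∃ u : kOf X pp.1 x, ‖u‖ ≤ ‖ϖ‖ ^ ((n₀ : ℤ) - 1) ∧ u ∉ (logUnits (kOf X pp.1 x) : Set (kOf X pp.1 x))) →
      (∃ z ∈ (logUnits (kOf X pp.1 x) : Set (kOf X pp.1 x)), (pp : ℝ) ^ lam ≤ ‖z‖) →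
        ∃ g ∈ ismDH logv x.1, ∃ y : kOf X pp.1 x, ‖y‖ ≤ 1 ∧
          (pp : ℝ) ^ (lam + ((-((-(n₀ : ℤ)) / (e : ℤ)) : ℤ) : ℝ)) ≤
            ‖(presAt X hlog pp).φ x (g (((presAt X hlog pp).φ x).symm y))‖ := by
  haveI : Fact (pp : ℕ).Prime := ⟨pp.2⟩
  intro ϖ hϖ hsharp hrad
  obtain ⟨u, hun, hu⟩ := hsharp
  obtain ⟨z, hz, hzn⟩ := hrad
  have hP1 : (1 : ℝ) < (pp : ℝ) := by exact_mod_cast (Fact.out : (pp : ℕ).Prime).one_lt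
  have hP0 : (0 : ℝ) < (pp : ℝ) := lt_trans zero_lt_one hP1
  have he0 : (0 : ℝ) < (e : ℝ) := by exact_mod_cast he
  -- the ceiling `C = ⌈n₀/e⌉`: `e·C ≤ n₀ + e − 1`
  set C : ℤ := -((-(n₀ : ℤ)) / (e : ℤ)) with hC
  have hCe : (e : ℤ) * C ≤ (n₀ : ℤ) + e - 1 := by
    have h1 := Int.mul_ediv_add_emod (-(n₀ : ℤ)) (e : ℤ)
    have h2 := Int.emod_lt_of_pos (-(n₀ : ℤ)) (show (0 : ℤ) < (e : ℤ) by exact_mod_cast he)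
    have h3 : (e : ℤ) * C = -((e : ℤ) * ((-(n₀ : ℤ)) / (e : ℤ))) := by rw [hC, mul_neg]
    linarith
  obtain ⟨g, hg, hgn⟩ := exists_mem_ismDH_norm_smul_ge_fibre X hlog pp x (((pp : ℕ) : ℚ_[pp]) ^ (1 - C)) u z hu hz
  refine ⟨g, hg, (((pp : ℕ) : ℚ_[pp]) ^ (1 - C)) • u, ?_, le_trans ?_ hgn⟩
  · -- integrality: `p^{C−1}·‖u‖ ≤ p^{C−1}·p^{−(n₀−1)/e} ≤ 1`
    rw [norm_smul, Padic.norm_p_zpow, neg_sub]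
    have hu' : ‖u‖ ≤ (pp : ℝ) ^ (-(1 : ℝ) / (e : ℝ) * (((n₀ : ℤ) - 1 : ℤ) : ℝ)) := by
      rw [Real.rpow_mul hP0.le, Real.rpow_intCast, ← hϖ]; exact hun
    calc (pp : ℝ) ^ (C - 1) * ‖u‖ ≤ (pp : ℝ) ^ (C - 1) * (pp : ℝ) ^ (-(1 : ℝ) / (e : ℝ) * (((n₀ : ℤ) - 1 : ℤ) : ℝ)) := by
          gcongr
      _ = (pp : ℝ) ^ (((C - 1 : ℤ) : ℝ) + -(1 : ℝ) / (e : ℝ) * (((n₀ : ℤ) - 1 : ℤ) : ℝ)) := by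
          rw [Real.rpow_add hP0, Real.rpow_intCast]
      _ ≤ (pp : ℝ) ^ (0 : ℝ) := by
          refine Real.rpow_le_rpow_of_exponent_le hP1.le ?_
          have hCe' : (e : ℝ) * (C : ℝ) ≤ (n₀ : ℝ) + e - 1 := by exact_mod_cast hCe
          rw [show ((C - 1 : ℤ) : ℝ) + -(1 : ℝ) / (e : ℝ) * (((n₀ : ℤ) - 1 : ℤ) : ℝ)
              = ((e : ℝ) * (C : ℝ) - ((n₀ : ℝ) + e - 1)) / (e : ℝ) by push_cast; field_simp; ring]
          exact div_nonpos_of_nonpos_of_nonneg (by linarith) he0.le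
      _ = 1 := Real.rpow_zero _
  · -- reach: `p^{λ + C} = p^{C−1}·p·p^{λ} ≤ ‖p^{1−C}‖·p·‖z‖`
    rw [Padic.norm_p_zpow, neg_sub]
    calc (pp : ℝ) ^ (lam + (C : ℝ)) = (pp : ℝ) ^ (C - 1) * (pp : ℝ) * (pp : ℝ) ^ lam := by
          rw [show lam + (C : ℝ) = (((C - 1 : ℤ) : ℝ) + 1) + lam by push_cast; ring, Real.rpow_add hP0,
            Real.rpow_add hP0, Real.rpow_intCast, Real.rpow_one]
      _ ≤ (pp : ℝ) ^ (C - 1) * (pp : ℝ) * ‖z‖ := by gcongr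

/-- **THE ACTIVE SLOT** at a BAD place `w ∣ p`: with the same dictionary and the Θ-idele `T` of norm `‖ϖ_w‖^{mΘ}`, the integral value
`y' := T⁻¹·p^{1−c}·u`, `c = ⌈(n₀ − mΘ)/e⌉ = −⌊(mΘ − n₀)/e⌋`, makes `T·y'` reach norm `≥ p^{λ + c}` under some `g ∈ Real.ismDH`.
[cite: WeilBNT1967, Ch. II §2, Th. 1] [cite: DupuyHilado2025, §4.9] -/
theorem exists_active (pp : Nat.Primes) (w : (thetaIndex X).Fibre (.inr pp)) (e n₀ : ℕ) (lam : ℝ) (mΘ : ℤ) (he : 1 ≤ e) :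
    haveI : Fact (pp : ℕ).Prime := ⟨pp.2⟩
    ∀ ϖ T : kOf X pp.1 w, ‖ϖ‖ = (pp : ℝ) ^ (-(1 : ℝ) / (e : ℝ)) → ‖T‖ = ‖ϖ‖ ^ mΘ →
      (∃ u : kOf X pp.1 w, ‖u‖ ≤ ‖ϖ‖ ^ ((n₀ : ℤ) - 1) ∧ u ∉ (logUnits (kOf X pp.1 w) : Set (kOf X pp.1 w))) →
      (∃ z ∈ (logUnits (kOf X pp.1 w) : Set (kOf X pp.1 w)), (pp : ℝ) ^ lam ≤ ‖z‖) →
        ∃ g ∈ ismDH logv w.1, ∃ y : kOf X pp.1 w, ‖y‖ ≤ 1 ∧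
          (pp : ℝ) ^ (-(((mΘ - n₀) / (e : ℤ) : ℤ) : ℝ) + lam) ≤
            ‖(presAt X hlog pp).φ w (g (((presAt X hlog pp).φ w).symm (T * y)))‖ := by
  haveI : Fact (pp : ℕ).Prime := ⟨pp.2⟩
  intro ϖ T hϖ hT hsharp hrad
  obtain ⟨u, hun, hu⟩ := hsharp
  obtain ⟨z, hz, hzn⟩ := hrad
  have hP1 : (1 : ℝ) < (pp : ℝ) := by exact_mod_cast (Fact.out : (pp : ℕ).Prime).one_lt
  have hP0 : (0 : ℝ) < (pp : ℝ) := lt_trans zero_lt_one hP1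
  have he0 : (0 : ℝ) < (e : ℝ) := by exact_mod_cast he
  have hϖ0 : (0 : ℝ) < ‖ϖ‖ := by rw [hϖ]; exact Real.rpow_pos_of_pos hP0 _
  have hT0 : T ≠ 0 := by
    rw [← norm_pos_iff, hT]; exact zpow_pos hϖ0 _
  have hTn : ‖T‖ = (pp : ℝ) ^ (-(1 : ℝ) / (e : ℝ) * (mΘ : ℝ)) := by
    rw [hT, hϖ, Real.rpow_mul hP0.le, Real.rpow_intCast]
  -- the ceiling `c = ⌈(n₀ − mΘ)/e⌉ = −⌊(mΘ − n₀)/e⌋`: `e·c ≤ e − (mΘ − n₀) − 1`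
  set c : ℤ := -((mΘ - n₀) / (e : ℤ)) with hc
  have hce : (e : ℤ) * c ≤ (e : ℤ) - (mΘ - n₀) - 1 := by
    have h1 := Int.mul_ediv_add_emod (mΘ - n₀) (e : ℤ)
    have h2 := Int.emod_lt_of_pos (mΘ - n₀) (show (0 : ℤ) < (e : ℤ) by exact_mod_cast he)
    have h3 : (e : ℤ) * c = -((e : ℤ) * ((mΘ - n₀) / (e : ℤ))) := by rw [hc, mul_neg]
    linarith
  obtain ⟨g, hg, hgn⟩ := exists_mem_ismDH_norm_smul_ge_fibre X hlog pp w (((pp : ℕ) : ℚ_[pp]) ^ (1 - c)) u z hu hz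
  refine ⟨g, hg, T⁻¹ * ((((pp : ℕ) : ℚ_[pp]) ^ (1 - c)) • u), ?_, ?_⟩
  · -- integrality: `p^{c−1}·‖u‖/‖T‖ ≤ p^{c−1}·p^{−(n₀−1)/e}·p^{mΘ/e} ≤ 1`
    rw [norm_mul, norm_inv, norm_smul, Padic.norm_p_zpow, neg_sub, hTn]
    have hu' : ‖u‖ ≤ (pp : ℝ) ^ (-(1 : ℝ) / (e : ℝ) * (((n₀ : ℤ) - 1 : ℤ) : ℝ)) := by
      rw [Real.rpow_mul hP0.le, Real.rpow_intCast, ← hϖ]; exact hun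
    calc ((pp : ℝ) ^ (-(1 : ℝ) / (e : ℝ) * (mΘ : ℝ)))⁻¹ * ((pp : ℝ) ^ (c - 1) * ‖u‖)
        ≤ ((pp : ℝ) ^ (-(1 : ℝ) / (e : ℝ) * (mΘ : ℝ)))⁻¹ *
            ((pp : ℝ) ^ (c - 1) * (pp : ℝ) ^ (-(1 : ℝ) / (e : ℝ) * (((n₀ : ℤ) - 1 : ℤ) : ℝ))) := by
          gcongr
      _ = (pp : ℝ) ^ (-(-(1 : ℝ) / (e : ℝ) * (mΘ : ℝ)) + (((c - 1 : ℤ) : ℝ) + -(1 : ℝ) / (e : ℝ) * (((n₀ : ℤ) - 1 : ℤ) : ℝ))) := by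
          rw [Real.rpow_add hP0, Real.rpow_add hP0, Real.rpow_neg hP0.le, Real.rpow_intCast]
      _ ≤ (pp : ℝ) ^ (0 : ℝ) := by
          refine Real.rpow_le_rpow_of_exponent_le hP1.le ?_
          have hce' : (e : ℝ) * (c : ℝ) ≤ (e : ℝ) - ((mΘ : ℝ) - n₀) - 1 := by exact_mod_cast hce
          rw [show -(-(1 : ℝ) / (e : ℝ) * (mΘ : ℝ)) + (((c - 1 : ℤ) : ℝ) + -(1 : ℝ) / (e : ℝ) * (((n₀ : ℤ) - 1 : ℤ) : ℝ))
              = ((e : ℝ) * (c : ℝ) - ((e : ℝ) - ((mΘ : ℝ) - n₀) - 1)) / (e : ℝ) by push_cast; field_simp; ring]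
          exact div_nonpos_of_nonpos_of_nonneg (by linarith) he0.le
      _ = 1 := Real.rpow_zero _
  · -- reach: `T·y' = p^{1−c}·u` is carried to norm `≥ ‖p^{1−c}‖·p·‖z‖ ≥ p^{c + λ}`
    rw [mul_inv_cancel_left₀ hT0]
    refine le_trans ?_ hgn
    rw [Padic.norm_p_zpow, neg_sub]
    calc (pp : ℝ) ^ (-(((mΘ - n₀) / (e : ℤ) : ℤ) : ℝ) + lam) = (pp : ℝ) ^ (c - 1) * (pp : ℝ) * (pp : ℝ) ^ lam := by
          rw [show -(((mΘ - n₀) / (e : ℤ) : ℤ) : ℝ) + lam = (((c - 1 : ℤ) : ℝ) + 1) + lam by rw [hc]; push_cast; ring,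
            Real.rpow_add hP0, Real.rpow_add hP0, Real.rpow_intCast, Real.rpow_one]
      _ ≤ (pp : ℝ) ^ (c - 1) * (pp : ℝ) * ‖z‖ := by gcongr

end Fibre

/-! ## §8. Bookkeeping: a product over the `j+1` slots dominated slot by slot -/

/-- A product over `Fin (n+1)` is at least `P^q` as soon as its last factor is `≥ P^{A_last}`, its `b`-th factor is `≥ P^{A_b}`
(`b < n`) and `q ≤ Σ_b A_b + A_last` (`P > 1`). [folklore] -/
theorem rpow_le_prod_of_slots {n : ℕ} {P q Al : ℝ} {A : Fin n → ℝ} {Φ : Fin (n + 1) → ℝ} (hP : 1 < P)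
    (hlast : P ^ Al ≤ Φ (Fin.last n)) (hdon : ∀ b : Fin n, P ^ (A b) ≤ Φ b.castSucc) (hq : q ≤ (∑ b, A b) + Al) :
    P ^ q ≤ ∏ a, Φ a := by
  have hP0 : 0 < P := lt_trans zero_lt_one hP
  rw [Fin.prod_univ_castSucc]
  calc P ^ q ≤ P ^ ((∑ b, A b) + Al) := Real.rpow_le_rpow_of_exponent_le hP.le hq
    _ = (∏ b, P ^ (A b)) * P ^ Al := by rw [Real.rpow_add hP0, Real.rpow_sum_of_pos hP0]
    _ ≤ (∏ b, Φ b.castSucc) * Φ (Fin.last n) :=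
        mul_le_mul (Finset.prod_le_prod (fun b _ => (Real.rpow_pos_of_pos hP0 _).le) fun b _ => hdon b) hlast
          (Real.rpow_pos_of_pos hP0 _).le
          (Finset.prod_nonneg fun b _ => (Real.rpow_pos_of_pos hP0 _).le.trans (hdon b))

/-! ## §9. THE MOVER LEMMA: `SlotReachWindow` ⟹ MULTI-REACH at every packet `(i+1, p)` (abc-iut-lens-wuc-1's sorry, discharged) -/

section Setting

variable {F : Type} [Field F] [NumberField F] (X : PilotData F) {logv : PadicLogs F} (hlog : LogvAnalytic logv)
  (tq : ∀ (pp : Nat.Primes) (x : (thetaIndex X).Fibre (.inr pp)), haveI : Fact (pp : ℕ).Prime := ⟨pp.2⟩; kOf X pp.1 x)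
  (t : ∀ (pp : Nat.Primes) (_ : Fin X.lstar) (x : (thetaIndex X).Fibre (.inr pp)),
    haveI : Fact (pp : ℕ).Prime := ⟨pp.2⟩; kOf X pp.1 x)
  (htq1 : ∀ (pp : Nat.Primes) (x : (thetaIndex X).Fibre (.inr pp)),
    haveI : Fact (pp : ℕ).Prime := ⟨pp.2⟩; placeOf X pp.1 x ∉ X.S → ‖tq pp x‖ = 1)
  -- the numeric dictionary of H⋆: per place `x | p` a uniformizer norm, the inner conductor and the outer radius of `log_p(𝒪_x^×)`
  (e n₀ : ∀ pp : Nat.Primes, (thetaIndex X).Fibre (.inr pp) → ℕ)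
  (lam : ∀ pp : Nat.Primes, (thetaIndex X).Fibre (.inr pp) → ℝ)
  (ϖ : ∀ (pp : Nat.Primes) (x : (thetaIndex X).Fibre (.inr pp)), haveI : Fact (pp : ℕ).Prime := ⟨pp.2⟩; kOf X pp.1 x)
  (mΘ : ∀ pp : Nat.Primes, Fin (thetaIndex X).lstar → (thetaIndex X).Fibre (.inr pp) → ℤ)
  (mq : ∀ pp : Nat.Primes, (thetaIndex X).Fibre (.inr pp) → ℤ)

include htq1 in
/-- **THE MOVER LEMMA (abc-iut-lens-wuc-1's `multiReach_of_slotReachWindow`, K2GLUE-slotreach.lean :82, statement verbatim, NOW PROVED):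
the SLOT-REACH WINDOW with its numeric dictionary gives abc-iut-w5-d107's MULTI-REACH at every packet `(i+1, p)`.** Dictionary: `e ≥ 1`
and `‖ϖ_x‖ = p^{−1/e_x}`; `hsharp` = a NON-member `u_x ∉ log_p(𝒪_x^×)` with `‖u_x‖ ≤ ‖ϖ_x‖^{n₀(x)−1}` (certifies `n₀ ≤ r_in`); `hrad` = a member
`z_x` with `‖z_x‖ ≥ p^{λ_x}` (certifies the outer radius); `hΘ`/`hq` = the orders of the Θ- and q-ideles at the bad places; `ht1` = Θ-ideles are units
off `S`. Movers: at a summand `v⃗ = (x_0,…,x_i,w)` with `w` BAD, every donor slot carries `p^{1−⌈n₀/e⌉}·u_{x_a}` to norm `≥ p^{λ+⌈n₀/e⌉}`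
(`exists_donor`) and the active slot carries `t_Θ·y'` to norm `≥ p^{λ_w − ⌊(mΘ−n₀)/e_w⌋}` (`exists_active`), so the product of the reached
norms is `≥ ‖t_{q,w}‖ = p^{−m_q/e_w}` exactly when the window inequality of `SlotReachWindow` holds at `(w, i, x⃗)`; with `w` GOOD both
ideles are units and the identity movers do. [cite: WeilBNT1967, Ch. II §2, Th. 1] [cite: DupuyHilado2025, §3.9, §4.9]
[cite: Mochizuki2012, IUTchIII Thm. 3.11 (i) (Ind2) p. 154] [claim: Mochizuki2012, status: disputed] -/
theorem multiReach_of_slotReachWindow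
    (he : ∀ pp x, 1 ≤ e pp x)
    (hϖ : ∀ (pp : Nat.Primes) (x : (thetaIndex X).Fibre (.inr pp)), haveI : Fact (pp : ℕ).Prime := ⟨pp.2⟩
      ‖ϖ pp x‖ = (pp : ℝ) ^ (-(1 : ℝ) / (e pp x : ℝ)))
    (hsharp : ∀ (pp : Nat.Primes) (x : (thetaIndex X).Fibre (.inr pp)), haveI : Fact (pp : ℕ).Prime := ⟨pp.2⟩
      ∃ u : kOf X pp.1 x, ‖u‖ ≤ ‖ϖ pp x‖ ^ ((n₀ pp x : ℤ) - 1) ∧ u ∉ (logUnits (kOf X pp.1 x) : Set (kOf X pp.1 x)))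
    (hrad : ∀ (pp : Nat.Primes) (x : (thetaIndex X).Fibre (.inr pp)), haveI : Fact (pp : ℕ).Prime := ⟨pp.2⟩
      ∃ z ∈ (logUnits (kOf X pp.1 x) : Set (kOf X pp.1 x)), (pp : ℝ) ^ (lam pp x) ≤ ‖z‖)
    (ht1 : ∀ (pp : Nat.Primes) (i : Fin X.lstar) (x : (thetaIndex X).Fibre (.inr pp)),
      haveI : Fact (pp : ℕ).Prime := ⟨pp.2⟩; placeOf X pp.1 x ∉ X.S → ‖t pp i x‖ = 1)
    (hΘ : ∀ (pp : Nat.Primes) (i : Fin X.lstar) (w : (thetaIndex X).Fibre (.inr pp)), haveI : Fact (pp : ℕ).Prime := ⟨pp.2⟩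
      placeOf X pp.1 w ∈ X.S → ‖t pp i w‖ = ‖ϖ pp w‖ ^ (mΘ pp i w))
    (hq : ∀ (pp : Nat.Primes) (w : (thetaIndex X).Fibre (.inr pp)), haveI : Fact (pp : ℕ).Prime := ⟨pp.2⟩
      placeOf X pp.1 w ∈ X.S → ‖tq pp w‖ = ‖ϖ pp w‖ ^ (mq pp w))
    (hH : SlotReachWindow (thetaIndex X).lstar (fun pp => (thetaIndex X).Fibre (.inr pp))
      (fun pp w => haveI : Fact (pp : ℕ).Prime := ⟨pp.2⟩; placeOf X pp.1 w ∈ X.S) e n₀ lam mΘ mq)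
    (pp : Nat.Primes) (i : Fin (thetaIndex X).lstar)
    (ev : (thetaIndex X).Caps (Setting.labelSucc i) → (thetaIndex X).Fibre (.inr pp)) :
    haveI : Fact (pp : ℕ).Prime := ⟨pp.2⟩
    ∃ g : (thetaIndex X).Caps (Setting.labelSucc i) → ∀ x : (thetaIndex X).Fibre (.inr pp),
        (logShellsDH X logv).carrier x.1 ≃ₗ[ℚ] (logShellsDH X logv).carrier x.1,
      (∀ a x, g a x ∈ (logShellsDH X logv).ism x.1) ∧
      ∃ y : ∀ a, kOf X pp.1 (ev a), (∀ a, ‖y a‖ ≤ 1) ∧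
        ‖tq pp (ev (Fin.last _))‖ ≤ ∏ a, ‖(presAt X hlog pp).φ (ev a) (g a (ev a) (((presAt X hlog pp).φ (ev a)).symm
          ((if a = Fin.last _ then t pp i (ev a) else 1) * y a)))‖ := by
  haveI : Fact (pp : ℕ).Prime := ⟨pp.2⟩
  classical
  by_cases hw : placeOf X pp.1 (ev (Fin.last _)) ∈ X.S
  · -- the last place is BAD: donor movers on the slots `a ≤ i`, the active mover on the last slot
    have hact : ∀ w : (thetaIndex X).Fibre (.inr pp), ∃ g ∈ ismDH logv w.1, ∃ y : kOf X pp.1 w, ‖y‖ ≤ 1 ∧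
        (placeOf X pp.1 w ∈ X.S → (pp : ℝ) ^ (-(((mΘ pp i w - n₀ pp w) / (e pp w : ℤ) : ℤ) : ℝ) + lam pp w) ≤
          ‖(presAt X hlog pp).φ w (g (((presAt X hlog pp).φ w).symm (t pp i w * y)))‖) := by
      intro w
      by_cases hwS : placeOf X pp.1 w ∈ X.S
      · obtain ⟨g, hg, y, hy, h⟩ := exists_active X hlog pp w (e pp w) (n₀ pp w) (lam pp w) (mΘ pp i w) (he pp w)
          (ϖ pp w) (t pp i w) (hϖ pp w) (hΘ pp i w hwS) (hsharp pp w) (hrad pp w)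
        exact ⟨g, hg, y, hy, fun _ => h⟩
      · exact ⟨LinearEquiv.refl ℚ _, refl_mem_ismDH logv _, 1, norm_one.le, fun h => absurd h hwS⟩
    choose gA hgA yA hyA hA using hact
    choose gD hgD yD hyD hD using fun x : (thetaIndex X).Fibre (.inr pp) =>
      exists_donor X hlog pp x (e pp x) (n₀ pp x) (lam pp x) (he pp x) (ϖ pp x) (hϖ pp x) (hsharp pp x) (hrad pp x)
    refine ⟨fun a x => if a = Fin.last _ then gA x else gD x, fun a x => ?_,
      fun a => if a = Fin.last _ then yA (ev a) else yD (ev a), fun a => ?_, ?_⟩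
    · rw [logShellsDH_ism]
      dsimp only
      split_ifs
      exacts [hgA x, hgD x]
    · dsimp only
      split_ifs
      exacts [hyA _, hyD _]
    · have hP1 : (1 : ℝ) < (pp : ℝ) := by exact_mod_cast (Fact.out : (pp : ℕ).Prime).one_lt
      have hP0 : (0 : ℝ) < (pp : ℝ) := lt_trans zero_lt_one hP1
      -- the q-idele norm at the bad last place
      have hqn : ‖tq pp (ev (Fin.last _))‖ =
          (pp : ℝ) ^ (-(1 : ℝ) / (e pp (ev (Fin.last _)) : ℝ) * (mq pp (ev (Fin.last _)) : ℝ)) := by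
        rw [hq pp _ hw, hϖ, ← Real.rpow_intCast, ← Real.rpow_mul hP0.le]
      -- the window inequality at `(w, i, x⃗)` rearranged as an exponent inequality
      have hexp : -(1 : ℝ) / (e pp (ev (Fin.last _)) : ℝ) * (mq pp (ev (Fin.last _)) : ℝ) ≤
          (∑ b : Fin ((i : ℕ) + 1), (lam pp (ev (Fin.castSucc b)) +
              ((-((-(n₀ pp (ev (Fin.castSucc b)) : ℤ)) / (e pp (ev (Fin.castSucc b)) : ℤ)) : ℤ) : ℝ))) +
            (-(((mΘ pp i (ev (Fin.last _)) - n₀ pp (ev (Fin.last _))) / (e pp (ev (Fin.last _)) : ℤ) : ℤ) : ℝ) +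
              lam pp (ev (Fin.last _))) := by
        have hwin := hH pp i (ev (Fin.last _)) hw (fun b => ev (Fin.castSucc b))
        have he0 : (0 : ℝ) < (e pp (ev (Fin.last _)) : ℝ) := by exact_mod_cast he pp _
        have hdiv : -(1 : ℝ) / (e pp (ev (Fin.last _)) : ℝ) * (mq pp (ev (Fin.last _)) : ℝ) =
            -((mq pp (ev (Fin.last _)) : ℝ) / (e pp (ev (Fin.last _)) : ℝ)) := by ring
        rw [hdiv]
        linarith
      rw [hqn]
      refine rpow_le_prod_of_slots (n := (i : ℕ) + 1) hP1 ?_ (fun b => ?_) hexp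
      · -- the active slot
        dsimp only
        split_ifs with h
        · exact hA _ hw
        · exact absurd rfl h
      · -- a donor slot
        dsimp only
        split_ifs with h
        · exact absurd h (Fin.castSucc_lt_last b).ne
        · rw [one_mul]
          exact hD _
  · -- the last place is GOOD: both ideles are units there, identity movers
    refine ⟨fun _ _ => LinearEquiv.refl ℚ _, fun a x => ?_, fun _ => 1, fun _ => norm_one.le, ?_⟩
    · rw [logShellsDH_ism]
      exact refl_mem_ismDH logv _
    · rw [htq1 pp _ hw]
      refine (Finset.prod_eq_one fun a _ => ?_).symm.le
      rw [LinearEquiv.refl_apply, LinearEquiv.apply_symm_apply, mul_one]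
      split_ifs with h
      · subst h
        exact ht1 pp i _ hw
      · exact (norm_one (α := kOf X pp.1 (ev a)))

end Setting

end Summit.ABC.IUTFork.Repair.RHSlotReach

end
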